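import Summits.Ventures.PercRepro.Night2LocalD2R14SixZeroB

/-!
# PercRepro — the six-element columns of R1₄ without a far preimage, part C: two coloops (night-2, gen 16)

The cell `κ = 2` of proofs/NIGHT-2-k1.md §7.1 in the tree's vocabulary: a six-element shadow set `S` with two coloops
`z₁ ≠ z₂` of `S` other than `y` (`zᵢ ∉ cl (S ∖ zᵢ)`), no far preimage.  The pair sets avoid the coloops
(`notMem_sdiff_of_mem_pairPre_of_coloop'`), so there are at most three pair preimages; every covering preimage is a
face `S ∖ {zᵢ}` (a third coloop is impossible at `|S| = 6`); when some face `S ∖ {zᵢ}` is a member the three pairs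
cannot all have `|G ∖ cl B| = 3` (`not_three_pairs_of_three'`).  Hence

**`sum_r14W_col_le_of_card_six_of_two_coloops`**: the column is `≤ 1` (`≤ 2087/2100`).
-/

namespace PercRepro.Shadow

open Finset PerFlat ThmH

variable {α : Type*} [DecidableEq α] {M : Matroid α} [M.Finite]

open scoped Classical in
/-- A coloop `z` of `S` (`z ∉ cl (S ∖ z)`) lies in no pair set. -/
theorem notMem_sdiff_of_mem_pairPre_of_coloop' {G : Finset α} (hG : G ∈ flatsQ M (4 + 1))
    {S : Finset α} (hS : S ∈ shadowAt M (4 + 2) 4 (Uq M (4 + 2) 4) G) {z : α} (hzS : z ∈ S)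
    (hz : z ∉ clF M (S.erase z)) {B : Finset α} (hB : B ∈ pairPre M 4 G S) : z ∉ S \ B := by
  intro hzX
  have hGg : G ⊆ gr M := (mem_flatsQ.1 hG).1
  have hSG : S ⊆ G := subset_of_mem_shadowAt hS
  have hBm := (mem_pairPre.1 hB).1
  have hU : B ∈ Uq M (4 + 2) 4 := (mem_membersIn.1 hBm).1
  have hBz : B ⊆ S.erase z := by
    intro e he
    rw [Finset.mem_erase]
    exact ⟨fun h => (Finset.mem_sdiff.1 hzX).2 (h ▸ he), subset_of_mem_pairPre hB he⟩
  have hSg : S.erase z ⊆ gr M := (Finset.erase_subset _ _).trans (hSG.trans hGg)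
  -- `ρ(S ∖ z) = 4`
  have hr : rkN M (S.erase z) = 4 := by
    have h := rkN_insert_coloop_eq (hSG.trans hGg) hzS hz (le_refl (S.erase z))
    rw [Finset.insert_erase hzS, rkN_eq_five_of_mem_shadowAt hS] at h
    omega
  have hreq : rkN M B = rkN M (S.erase z) := by rw [rkN_eq_of_mem_Uq hU, hr]
  have hcl := subset_closure_of_rkN_eq (M := M) hSg hBz hreq
  have hc := card_sdiff_of_mem_pairPre hB
  obtain ⟨x, w, hxw, hxy⟩ := Finset.card_eq_two.1 hc
  have hw : ∃ w ∈ S \ B, w ≠ z := by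
    rw [hxy] at hzX ⊢
    simp only [Finset.mem_insert, Finset.mem_singleton] at hzX
    rcases hzX with rfl | rfl
    · exact ⟨w, by simp, fun h => hxw h.symm⟩
    · exact ⟨x, by simp, hxw⟩
  obtain ⟨w, hwX, hwz⟩ := hw
  have hwS : w ∈ S.erase z := Finset.mem_erase.2 ⟨hwz, (Finset.mem_sdiff.1 hwX).1⟩
  have hwcl : w ∈ clF M B := by
    rw [mem_clF_iff]
    exact hcl (Finset.mem_coe.2 hwS)
  exact (Finset.mem_sdiff.1 (sdiff_subset_of_mem_pairPre hB hwX)).2 hwcl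

open scoped Classical in
/-- At `|S| = 6` there are at most two coloops of `S` other than `y` (simple matroid): three would leave
`S ∖ {y, z₁, z₂, z₃}` of rank `1`. -/
theorem eq_or_eq_of_coloop_six {G : Finset α} (hG : G ∈ flatsQ M (4 + 1))
    (hsimple : ∀ e ∈ gr M, ∀ f ∈ gr M, e ≠ f → rkN M {e, f} = 2) {y : α} (hyG : y ∈ G)
    (hyc : y ∉ clF M (G.erase y)) {S : Finset α} (hS : S ∈ shadowAt M (4 + 2) 4 (Uq M (4 + 2) 4) G)
    (h6 : S.card = 6) {z₁ z₂ z₃ : α} (hz₁S : z₁ ∈ S) (hz₂S : z₂ ∈ S) (hz₃S : z₃ ∈ S) (hz₁y : z₁ ≠ y)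
    (hz₂y : z₂ ≠ y) (hz₃y : z₃ ≠ y) (hz₁₂ : z₁ ≠ z₂) (hz₁ : z₁ ∉ clF M (S.erase z₁))
    (hz₂ : z₂ ∉ clF M (S.erase z₂)) (hz₃ : z₃ ∉ clF M (S.erase z₃)) : z₃ = z₁ ∨ z₃ = z₂ := by
  by_contra hcon
  rw [not_or] at hcon
  obtain ⟨hz₁₃, hz₂₃⟩ := hcon
  have hz₁₃ : z₁ ≠ z₃ := fun h => hz₁₃ h.symm
  have hz₂₃ : z₂ ≠ z₃ := fun h => hz₂₃ h.symm
  have hGg : G ⊆ gr M := (mem_flatsQ.1 hG).1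
  have hSG : S ⊆ G := subset_of_mem_shadowAt hS
  have hyS : y ∈ S := mem_of_mem_shadowAt_of_coloop (by rw [rkN_erase_eq_of_coloop hG hyG hyc]) hS
  set T := S \ {y, z₁, z₂, z₃} with hTdef
  have hT₃ : T ⊆ S.erase z₃ := by
    intro e he
    rw [hTdef, Finset.mem_sdiff] at he
    simp only [Finset.mem_insert, Finset.mem_singleton, not_or] at he
    exact Finset.mem_erase.2 ⟨he.2.2.2.2, he.1⟩
  have h3 := rkN_insert_coloop_eq (hSG.trans hGg) hz₃S hz₃ hT₃
  have hT₂ : insert z₃ T ⊆ S.erase z₂ := by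
    intro e he
    rw [Finset.mem_insert] at he
    rcases he with rfl | he
    · exact Finset.mem_erase.2 ⟨hz₂₃.symm, hz₃S⟩
    · rw [hTdef, Finset.mem_sdiff] at he
      simp only [Finset.mem_insert, Finset.mem_singleton, not_or] at he
      exact Finset.mem_erase.2 ⟨he.2.2.2.1, he.1⟩
  have h2 := rkN_insert_coloop_eq (hSG.trans hGg) hz₂S hz₂ hT₂
  have hT₁ : insert z₂ (insert z₃ T) ⊆ S.erase z₁ := by
    intro e he
    rw [Finset.mem_insert, Finset.mem_insert] at he
    rcases he with rfl | rfl | he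
    · exact Finset.mem_erase.2 ⟨hz₁₂.symm, hz₂S⟩
    · exact Finset.mem_erase.2 ⟨hz₁₃.symm, hz₃S⟩
    · rw [hTdef, Finset.mem_sdiff] at he
      simp only [Finset.mem_insert, Finset.mem_singleton, not_or] at he
      exact Finset.mem_erase.2 ⟨he.2.2.1, he.1⟩
  have h1 := rkN_insert_coloop_eq (hSG.trans hGg) hz₁S hz₁ hT₁
  have hTy : insert z₁ (insert z₂ (insert z₃ T)) ⊆ G.erase y := by
    intro e he
    rw [Finset.mem_insert, Finset.mem_insert, Finset.mem_insert] at he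
    rcases he with rfl | rfl | rfl | he
    · exact Finset.mem_erase.2 ⟨hz₁y, hSG hz₁S⟩
    · exact Finset.mem_erase.2 ⟨hz₂y, hSG hz₂S⟩
    · exact Finset.mem_erase.2 ⟨hz₃y, hSG hz₃S⟩
    · rw [hTdef, Finset.mem_sdiff] at he
      simp only [Finset.mem_insert, Finset.mem_singleton, not_or] at he
      exact Finset.mem_erase.2 ⟨he.2.1, hSG he.1⟩
  have h0 := rkN_insert_coloop_eq hGg hyG hyc hTy
  have hSeq : S = insert y (insert z₁ (insert z₂ (insert z₃ T))) := by
    ext e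
    simp only [hTdef, Finset.mem_insert, Finset.mem_sdiff, Finset.mem_singleton, not_or]
    constructor
    · intro he
      by_cases hey : e = y
      · exact Or.inl hey
      by_cases he₁ : e = z₁
      · exact Or.inr (Or.inl he₁)
      by_cases he₂ : e = z₂
      · exact Or.inr (Or.inr (Or.inl he₂))
      by_cases he₃ : e = z₃
      · exact Or.inr (Or.inr (Or.inr (Or.inl he₃)))
      exact Or.inr (Or.inr (Or.inr (Or.inr ⟨he, hey, he₁, he₂, he₃⟩)))
    · rintro (rfl | rfl | rfl | rfl | ⟨he, -⟩)
      · exact hyS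
      · exact hz₁S
      · exact hz₂S
      · exact hz₃S
      · exact he
  have h5 : rkN M (insert y (insert z₁ (insert z₂ (insert z₃ T)))) = 5 := by
    rw [← hSeq]
    exact rkN_eq_five_of_mem_shadowAt hS
  have hT1 : rkN M T ≤ 1 := by omega
  have hTg : T ⊆ gr M := by
    rw [hTdef]
    exact Finset.sdiff_subset.trans (hSG.trans hGg)
  have hTc := card_le_one_of_rkN_le_one hsimple hTg hT1
  have hSc : S.card ≤ T.card + 4 := by
    rw [hSeq]
    have := Finset.card_insert_le y (insert z₁ (insert z₂ (insert z₃ T)))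
    have := Finset.card_insert_le z₁ (insert z₂ (insert z₃ T))
    have := Finset.card_insert_le z₂ (insert z₃ T)
    have := Finset.card_insert_le z₃ T
    omega
  omega

open scoped Classical in
/-- **Three pair preimages all of `|G ∖ cl B| = 3` are impossible with a member face `S ∖ {z₁}` and a second coloop `z₂`**: their closures pairwise meet inside `Λ = cl {y, z₁, z₂}`, so `G ∖ S ⊆ Λ ∪ {one point}` and
`S ∖ {z₁}` could not be a member (`ρ(E ∖ (S ∖ z₁)) ≤ 5`). -/
theorem not_three_pairs_of_three' {G : Finset α} (hG : G ∈ flatsQ M (4 + 1)) (hd : (gr M \ G).card = 2)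
    (hsimple : ∀ e ∈ gr M, ∀ f ∈ gr M, e ≠ f → rkN M {e, f} = 2) {y : α} (hyG : y ∈ G)
    (hyc : y ∉ clF M (G.erase y)) {S : Finset α} (hS : S ∈ shadowAt M (4 + 2) 4 (Uq M (4 + 2) 4) G)
    {z₁ z₂ : α} (hz₁S : z₁ ∈ S) (hz₂S : z₂ ∈ S) (hz₁y : z₁ ≠ y) (hz₂y : z₂ ≠ y) (hz₁₂ : z₁ ≠ z₂)
    (hm₁ : S.erase z₁ ∈ membersIn M (Uq M (4 + 2) 4) G) (hz₂ : z₂ ∉ clF M (S.erase z₂))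
    {B₁ B₂ B₃ : Finset α} (hB₁ : B₁ ∈ pairPre M 4 G S) (hB₂ : B₂ ∈ pairPre M 4 G S) (hB₃ : B₃ ∈ pairPre M 4 G S)
    (h₁₂ : B₁ ≠ B₂) (h₁₃ : B₁ ≠ B₃) (h₂₃ : B₂ ≠ B₃) (hc₁ : (G \ clF M B₁).card = 3) (hc₂ : (G \ clF M B₂).card = 3)
    (hc₃ : (G \ clF M B₃).card = 3) : False := by
  have hGg : G ⊆ gr M := (mem_flatsQ.1 hG).1
  have hSG : S ⊆ G := subset_of_mem_shadowAt hS
  have hyS : y ∈ S := mem_of_mem_shadowAt_of_coloop (by rw [rkN_erase_eq_of_coloop hG hyG hyc]) hS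
  set Λ₀ : Finset α := {y, z₁, z₂} with hΛ₀def
  have hΛ₀S : Λ₀ ⊆ S := by
    intro e he
    rw [hΛ₀def, Finset.mem_insert, Finset.mem_insert, Finset.mem_singleton] at he
    rcases he with rfl | rfl | rfl
    · exact hyS
    · exact hz₁S
    · exact hz₂S
  -- `Λ₀ ⊆ Bᵢ` for every pair preimage
  have hΛ₀B : ∀ B ∈ pairPre M 4 G S, Λ₀ ⊆ B := by
    intro B hB e he
    rw [hΛ₀def, Finset.mem_insert, Finset.mem_insert, Finset.mem_singleton] at he
    rcases he with rfl | rfl | rfl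
    · exact mem_of_mem_pairPre hG hyG hyc hB
    · by_contra h
      exact notMem_sdiff_of_mem_pairPre_of_coloop hG hm₁ hB (Finset.mem_sdiff.2 ⟨hz₁S, h⟩)
    · by_contra h
      exact notMem_sdiff_of_mem_pairPre_of_coloop' hG hS hz₂S hz₂ hB (Finset.mem_sdiff.2 ⟨hz₂S, h⟩)
  have hΛ₀r : 3 ≤ rkN M Λ₀ := by
    have hRe : ({z₁, z₂} : Finset α) ⊆ G.erase y := by
      intro e he
      rw [Finset.mem_insert, Finset.mem_singleton] at he
      rcases he with rfl | rfl
      · exact Finset.mem_erase.2 ⟨hz₁y, hSG hz₁S⟩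
      · exact Finset.mem_erase.2 ⟨hz₂y, hSG hz₂S⟩
    have := three_le_rkN_insert_of_two_le_card hGg hyG hyc hsimple hRe (by rw [Finset.card_pair hz₁₂])
    exact this
  set Λ := clF M Λ₀ with hΛdef
  have hΛG : Λ ⊆ G := (clF_mono (hΛ₀B B₁ hB₁)).trans (mem_membersIn.1 (mem_pairPre.1 hB₁).1).2
  have hI : ∀ B B' : Finset α, B ∈ pairPre M 4 G S → B' ∈ pairPre M 4 G S → B ≠ B' → clF M B ∩ clF M B' ⊆ Λ :=
    fun B B' hB hB' hne => clF_inter_subset_clF_of_three_le hG hB hB' hne (hΛ₀B B hB) (hΛ₀B B' hB') hΛ₀r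
  -- `|(G ∖ S) ∖ cl Bᵢ| = 1`
  have hone : ∀ B ∈ pairPre M 4 G S, (G \ clF M B).card = 3 → ((G \ S) \ clF M B).card = 1 := by
    intro B hB hc
    have hU : B ∈ Uq M (4 + 2) 4 := (mem_membersIn.1 (mem_pairPre.1 hB).1).1
    have hdecomp : G \ clF M B = ((G \ S) \ clF M B) ∪ (S \ B) := by
      ext e
      rw [Finset.mem_union, Finset.mem_sdiff, Finset.mem_sdiff, Finset.mem_sdiff, Finset.mem_sdiff]
      constructor
      · rintro ⟨heG, hecl⟩
        by_cases heS : e ∈ S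
        · exact Or.inr ⟨heS, fun h => hecl (subset_clF hU h)⟩
        · exact Or.inl ⟨⟨heG, heS⟩, hecl⟩
      · rintro (⟨⟨heG, -⟩, hecl⟩ | he)
        · exact ⟨heG, hecl⟩
        · exact ⟨hSG he.1, (Finset.mem_sdiff.1 (sdiff_subset_of_mem_pairPre hB (Finset.mem_sdiff.2 he))).2⟩
    have hdisj : Disjoint ((G \ S) \ clF M B) (S \ B) := by
      rw [Finset.disjoint_left]
      intro e he he'
      exact (Finset.mem_sdiff.1 (Finset.mem_sdiff.1 he).1).2 (Finset.mem_sdiff.1 he').1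
    rw [hdecomp, Finset.card_union_of_disjoint hdisj, card_sdiff_of_mem_pairPre hB] at hc
    omega
  -- `W = (G ∖ S) ∖ Λ` has at most one point
  set W := (G \ S) \ Λ with hWdef
  have hW : W.card ≤ 1 := by
    have hpart : ∀ B ∈ pairPre M 4 G S, (G \ clF M B).card = 3 → W.card ≤ (W ∩ clF M B).card + 1 := by
      intro B hB hc
      have h1 := Finset.card_sdiff_add_card_inter W (clF M B)
      have h2 : W \ clF M B ⊆ (G \ S) \ clF M B := Finset.sdiff_subset_sdiff Finset.sdiff_subset (le_refl _)
      have h3 := Finset.card_le_card h2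
      rw [hone B hB hc] at h3
      omega
    have hd₁₂ : Disjoint (W ∩ clF M B₁) (W ∩ clF M B₂) := by
      rw [Finset.disjoint_left]
      intro e he he'
      exact (Finset.mem_sdiff.1 (Finset.mem_inter.1 he).1).2
        (hI B₁ B₂ hB₁ hB₂ h₁₂ (Finset.mem_inter.2 ⟨(Finset.mem_inter.1 he).2, (Finset.mem_inter.1 he').2⟩))
    have hd₁₃ : Disjoint (W ∩ clF M B₁) (W ∩ clF M B₃) := by
      rw [Finset.disjoint_left]
      intro e he he'
      exact (Finset.mem_sdiff.1 (Finset.mem_inter.1 he).1).2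
        (hI B₁ B₃ hB₁ hB₃ h₁₃ (Finset.mem_inter.2 ⟨(Finset.mem_inter.1 he).2, (Finset.mem_inter.1 he').2⟩))
    have hd₂₃ : Disjoint (W ∩ clF M B₂) (W ∩ clF M B₃) := by
      rw [Finset.disjoint_left]
      intro e he he'
      exact (Finset.mem_sdiff.1 (Finset.mem_inter.1 he).1).2
        (hI B₂ B₃ hB₂ hB₃ h₂₃ (Finset.mem_inter.2 ⟨(Finset.mem_inter.1 he).2, (Finset.mem_inter.1 he').2⟩))
    have hu : ((W ∩ clF M B₁) ∪ (W ∩ clF M B₂) ∪ (W ∩ clF M B₃)).card ≤ W.card :=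
      Finset.card_le_card (Finset.union_subset (Finset.union_subset Finset.inter_subset_left
        Finset.inter_subset_left) Finset.inter_subset_left)
    rw [Finset.card_union_of_disjoint (Finset.disjoint_union_left.2 ⟨hd₁₃, hd₂₃⟩),
      Finset.card_union_of_disjoint hd₁₂] at hu
    have := hpart B₁ hB₁ hc₁
    have := hpart B₂ hB₂ hc₂
    have := hpart B₃ hB₃ hc₃
    omega
  -- `S ∖ {z₁}` is not a member: `G ∖ (S ∖ z₁) ⊆ (Λ ∖ y) ∪ W` has rank `≤ 3`
  have hΛr : rkN M (Λ.erase y) ≤ 2 := by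
    have hyΛ : y ∈ Λ := subset_clF_of_subset_gr (hΛ₀S.trans (hSG.trans hGg)) (by
      rw [hΛ₀def]; exact Finset.mem_insert_self _ _)
    have h := rkN_insert_coloop_eq hGg hyG hyc (Finset.erase_subset_erase _ hΛG : Λ.erase y ⊆ G.erase y)
    rw [Finset.insert_erase hyΛ] at h
    have h1 : rkN M Λ ≤ rkN M Λ₀ := rkN_le_of_subset_clF' (M := M) (le_refl _)
    have h2 := rkN_le_card_fin (M := M) Λ₀
    have h3 : Λ₀.card ≤ 3 := Finset.card_le_three
    omega
  have hsub : G \ S.erase z₁ ⊆ (Λ.erase y) ∪ W := by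
    intro e he
    rw [Finset.mem_sdiff, Finset.mem_erase, not_and] at he
    rw [Finset.mem_union, Finset.mem_erase, hWdef, Finset.mem_sdiff, Finset.mem_sdiff]
    by_cases heS : e ∈ S
    · have hez : e = z₁ := by
        by_contra h
        exact he.2 h heS
      subst hez
      exact Or.inl ⟨hz₁y, subset_clF_of_subset_gr (hΛ₀S.trans (hSG.trans hGg)) (by
        rw [hΛ₀def]; exact Finset.mem_insert_of_mem (Finset.mem_insert_self _ _))⟩
    · by_cases heΛ : e ∈ Λ
      · exact Or.inl ⟨fun h => heS (h ▸ hyS), heΛ⟩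
      · exact Or.inr ⟨⟨he.1, heS⟩, heΛ⟩
  have hU₁ : S.erase z₁ ∈ Uq M (4 + 2) 4 := (mem_membersIn.1 hm₁).1
  have h6 := rkN_sdiff_eq_of_mem_Uq hU₁
  have h1 : gr M \ S.erase z₁ ⊆ (G \ S.erase z₁) ∪ (gr M \ G) := by
    intro t ht
    rw [Finset.mem_sdiff] at ht
    rw [Finset.mem_union, Finset.mem_sdiff, Finset.mem_sdiff]
    by_cases htG : t ∈ G
    · exact Or.inl ⟨htG, ht.2⟩
    · exact Or.inr ⟨ht.1, htG⟩
  have h2 := rkN_mono (M := M) h1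
  have h3 := rkN_union_le_rkN_add_card (M := M) (G \ S.erase z₁) (gr M \ G)
  have h4 := rkN_mono (M := M) hsub
  have h5 := rkN_union_le_rkN_add_card (M := M) (Λ.erase y) W
  omega

open scoped Classical in
/-- With two coloops `z₁ ≠ z₂` of `S` (other than `y`) every pair set is a 2-subset of `S ∖ {y, z₁, z₂}`: at most
three pair preimages. -/
theorem card_pairPre_le_three_of_two_coloops {G : Finset α} (hG : G ∈ flatsQ M (4 + 1)) {y : α} (hyG : y ∈ G)
    (hyc : y ∉ clF M (G.erase y)) {S : Finset α} (hS : S ∈ shadowAt M (4 + 2) 4 (Uq M (4 + 2) 4) G)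
    (h6 : S.card = 6) {z₁ z₂ : α} (hz₁S : z₁ ∈ S) (hz₂S : z₂ ∈ S) (hz₁y : z₁ ≠ y) (hz₂y : z₂ ≠ y) (hz₁₂ : z₁ ≠ z₂)
    (hz₁ : z₁ ∉ clF M (S.erase z₁)) (hz₂ : z₂ ∉ clF M (S.erase z₂)) : (pairPre M 4 G S).card ≤ 3 := by
  have hyS : y ∈ S := mem_of_mem_shadowAt_of_coloop (by rw [rkN_erase_eq_of_coloop hG hyG hyc]) hS
  have hmaps : ∀ B ∈ pairPre M 4 G S, S \ B ∈ Finset.powersetCard 2 (S \ {y, z₁, z₂}) := by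
    intro B hB
    rw [Finset.mem_powersetCard]
    refine ⟨?_, card_sdiff_of_mem_pairPre hB⟩
    intro e he
    have h₁ := notMem_sdiff_of_mem_pairPre_of_coloop' hG hS hz₁S hz₁ hB
    have h₂ := notMem_sdiff_of_mem_pairPre_of_coloop' hG hS hz₂S hz₂ hB
    rw [Finset.mem_sdiff, Finset.mem_insert, Finset.mem_insert, Finset.mem_singleton, not_or, not_or]
    exact ⟨(Finset.mem_sdiff.1 he).1, fun h => (Finset.mem_sdiff.1 he).2 (h ▸ mem_of_mem_pairPre hG hyG hyc hB),
      fun h => h₁ (h ▸ he), fun h => h₂ (h ▸ he)⟩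
  have hinj : Set.InjOn (fun B => S \ B) (pairPre M 4 G S : Set (Finset α)) := by
    intro B hB B' hB' h
    by_contra hne
    exact sdiff_ne_of_mem_pairPre (Finset.mem_coe.1 hB) (Finset.mem_coe.1 hB') hne h
  have h1 := Finset.card_le_card_of_injOn (fun B => S \ B) hmaps hinj
  have hc : (S \ {y, z₁, z₂}).card = 3 := by
    have h3 : ({y, z₁, z₂} : Finset α).card = 3 := by
      rw [Finset.card_insert_of_notMem, Finset.card_pair hz₁₂]
      rw [Finset.mem_insert, Finset.mem_singleton, not_or]
      exact ⟨hz₁y.symm, hz₂y.symm⟩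
    have hsub3 : ({y, z₁, z₂} : Finset α) ⊆ S := by
      intro e he
      rw [Finset.mem_insert, Finset.mem_insert, Finset.mem_singleton] at he
      rcases he with rfl | rfl | rfl
      · exact hyS
      · exact hz₁S
      · exact hz₂S
    have := Finset.card_sdiff_add_card_eq_card hsub3
    omega
  rw [Finset.card_powersetCard, hc] at h1
  have h33 : Nat.choose 3 2 = 3 := by decide
  omega

open scoped Classical in
/-- With two coloops `z₁ ≠ z₂` of `S` (other than `y`) at most three points of `S ∖ {y}` carry a member basis. -/
theorem card_basisPts_le_three_of_two_coloops {G : Finset α} (hG : G ∈ flatsQ M (4 + 1)) {y : α} (hyG : y ∈ G)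
    (hyc : y ∉ clF M (G.erase y)) {S : Finset α} (hS : S ∈ shadowAt M (4 + 2) 4 (Uq M (4 + 2) 4) G)
    (h6 : S.card = 6) {z₁ z₂ : α} (hz₁S : z₁ ∈ S) (hz₂S : z₂ ∈ S) (hz₁y : z₁ ≠ y) (hz₂y : z₂ ≠ y) (hz₁₂ : z₁ ≠ z₂)
    (hz₁ : z₁ ∉ clF M (S.erase z₁)) (hz₂ : z₂ ∉ clF M (S.erase z₂)) : ((S.erase y).filter (fun x => (S.erase y).erase x ∈ membersIn M (Uq M (4 + 2) 4) G)).card ≤ 3 := by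
  have hGg : G ⊆ gr M := (mem_flatsQ.1 hG).1
  have hSG : S ⊆ G := subset_of_mem_shadowAt hS
  have hyS : y ∈ S := mem_of_mem_shadowAt_of_coloop (by rw [rkN_erase_eq_of_coloop hG hyG hyc]) hS
  have hnot : ∀ z ∈ S, z ≠ y → z ∉ clF M (S.erase z) → z ∉ (S.erase y).filter (fun x => (S.erase y).erase x ∈ membersIn M (Uq M (4 + 2) 4) G) := by
    intro z hzS hzy hz hmem
    rw [Finset.mem_filter] at hmem
    have hU : (S.erase y).erase z ∈ Uq M (4 + 2) 4 := (mem_membersIn.1 hmem.2).1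
    have hr4 := rkN_eq_of_mem_Uq hU
    have hsub : (S.erase y).erase z ⊆ S.erase z := by
      intro e he
      rw [Finset.mem_erase, Finset.mem_erase] at he
      exact Finset.mem_erase.2 ⟨he.1, he.2.2⟩
    have h1 := rkN_insert_coloop_eq (hSG.trans hGg) hzS hz hsub
    have hsub2 : insert z ((S.erase y).erase z) ⊆ G.erase y := by
      intro e he
      rw [Finset.mem_insert] at he
      rcases he with rfl | he
      · exact Finset.mem_erase.2 ⟨hzy, hSG hzS⟩
      · rw [Finset.mem_erase, Finset.mem_erase] at he
        exact Finset.mem_erase.2 ⟨he.2.1, hSG he.2.2⟩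
    have h2 := rkN_insert_coloop_eq hGg hyG hyc hsub2
    have hSeq : insert y (insert z ((S.erase y).erase z)) = S := by
      rw [Finset.insert_erase (Finset.mem_erase.2 ⟨hzy, hzS⟩), Finset.insert_erase hyS]
    rw [hSeq, rkN_eq_five_of_mem_shadowAt hS] at h2
    omega
  have hsub : (S.erase y).filter (fun x => (S.erase y).erase x ∈ membersIn M (Uq M (4 + 2) 4) G) ⊆ (S.erase y) \ {z₁, z₂} := by
    intro x hx
    have hxS : x ∈ S.erase y := Finset.mem_of_mem_filter x hx
    rw [Finset.mem_sdiff, Finset.mem_insert, Finset.mem_singleton, not_or]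
    exact ⟨hxS, fun h => hnot z₁ hz₁S hz₁y hz₁ (h ▸ hx), fun h => hnot z₂ hz₂S hz₂y hz₂ (h ▸ hx)⟩
  have h1 := Finset.card_le_card hsub
  have h3 : ({z₁, z₂} : Finset α) ⊆ S.erase y := by
    intro e he
    rw [Finset.mem_insert, Finset.mem_singleton] at he
    rcases he with rfl | rfl
    · exact Finset.mem_erase.2 ⟨hz₁y, hz₁S⟩
    · exact Finset.mem_erase.2 ⟨hz₂y, hz₂S⟩
  have h4 := Finset.card_sdiff_add_card_eq_card h3
  rw [Finset.card_erase_of_mem hyS, h6, Finset.card_pair hz₁₂] at h4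
  omega

end PercRepro.Shadow
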